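import Literature.NumberTheory.Sieve.PolymathSieveAsymptotics
import Mathlib.Analysis.Distribution.SchwartzSpace.Fourier
import Mathlib.Analysis.Fourier.FourierTransformDeriv
import Mathlib.Analysis.Fourier.Inversion
import Mathlib.Analysis.SpecialFunctions.SmoothTransition
import Mathlib.Analysis.SpecialFunctions.ImproperIntegrals
import HarnessLib

/-!
# Polymath 8b, Lemma 4.1: the Fourier expansion (etf) of the sieve cutoffs and the identity `∫∫ … = ∫_0^∞ F'G'`

Trunk: AntSieve / parity.S13.  Part of the proof (fifth layer of the decomposition of the named fact
`Literature.NumberTheory.Sieve.frequently_nth_prime_succ_le_add_polymath`, `H₁ ≤ 246`) of the key asymptotic Lemma 4.1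
of D. H. J. Polymath, *Variants of the Selberg sieve, and bounded intervals containing many primes*,
Res. Math. Sci. 1:12 (2014) = arXiv:1407.4897, pp. 12–13 (the named fact
`Literature.NumberTheory.Sieve.moebiusLcmSums_asymptotic` of `PolymathLcmSums.lean`).  This file supplies the Fourier-analytic
ingredients of that proof, all PROVED from Mathlib (Schwartz functions, Fourier inversion):

* `expMulExt F = Φ_F`, the smooth compactly supported extension of `t ↦ e^t F(t)` ("may be extended to
  smooth compactly supported functions on all of `ℝ`"), `IsSieveCutoff.schwartzExt`,
  `IsSieveCutoff.fourierWeight` (the paper's `f_j`, here `f = 𝓕 Φ_F` in Mathlib's normalisation, so the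
  paper's `e^{-itξ}` becomes `e^{2πitξ}` and `1+iξ` becomes `1-2πiξ`), rapid decay
  (`fourierWeight_decay`), and the expansion (etf): `F(t) = ∫ f(ξ) e^{-t(1-2πiξ)} dξ` for `t ≥ -1`
  (`eq_integral_fourierWeight`, kernel `lcmFourierKernel`) and
  `F'(t) = -∫ (1-2πiξ) f(ξ) e^{-t(1-2πiξ)} dξ` (`deriv_eq_integral_fourierWeight`);
* the identity closing the proof of Lemma 4.1 (p. 13):
  `∫∫ (1-2πiξ)(1-2πiξ')/(2-2πi(ξ+ξ')) f(ξ)g(ξ') dξdξ' = ∫_0^∞ F'(t)G'(t) dt`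
  (`integral_Ioi_deriv_mul_deriv_eq`, kernel `lcmPairKernel`), by Fubini;
* tail and integrability lemmas for the weights (`integrable_pow_mul_norm_fourierWeight`,
  `setIntegral_tail_fourierWeight_le`).

## References

* D. H. J. Polymath, *Variants of the Selberg sieve, and bounded intervals containing many primes*,
  Res. Math. Sci. 1 (2014), Art. 12; arXiv:1407.4897, proof of Lemma 4.1, pp. 12–13, (etf).
  [Polymath8b2014]
-/

noncomputable section

open MeasureTheory Filter Finset Asymptotics Real Complex FourierTransform
open scoped BigOperators Topology ContDiff SchwartzMap

namespace Literature.NumberTheory.Sieve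

/-! ### The smooth compactly supported extension of `e^t F(t)` -/

/-- `Φ_F(t) := χ(t) e^t F(t)` with `χ(t) = smoothTransition (t + 2)` (`= 1` for `t ≥ -1`, `= 0` for
`t ≤ -2`): the extension of `t ↦ e^t F(t)` (`t ≥ 0`) to a smooth compactly supported function on
`ℝ` used in the proof of Polymath 8b Lemma 4.1 ("the functions `t ↦ e^t F_j(t)` may be extended to
smooth compactly supported functions on all of `ℝ`", p. 12). [cite: Polymath8b2014, Lemma 4.1 (proof)] -/
def expMulExt (F : ℝ → ℝ) (t : ℝ) : ℝ :=
  Real.smoothTransition (t + 2) * (Real.exp t * F t)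

/-- `Φ_F(t) = e^t F(t)` for `t ≥ -1`. [cite: Polymath8b2014, Lemma 4.1 (proof)] -/
theorem expMulExt_eq {F : ℝ → ℝ} {t : ℝ} (ht : -1 ≤ t) : expMulExt F t = Real.exp t * F t := by
  rw [expMulExt, Real.smoothTransition.one_of_one_le (by linarith), one_mul]

/-- `Φ_F` is smooth when `F` is. [folklore] -/
theorem contDiff_expMulExt {F : ℝ → ℝ} (hF : ContDiff ℝ ∞ F) : ContDiff ℝ ∞ (expMulExt F) :=
  (Real.smoothTransition.contDiff.comp (contDiff_id.add contDiff_const)).mul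
    (Real.contDiff_exp.mul hF)

/-- `Φ_F` vanishes outside `[-2, s]` when `S(F) ≤ s`. [folklore] -/
theorem expMulExt_eq_zero {F : ℝ → ℝ} {s : ℝ} (hF : IsSieveCutoff F s) {t : ℝ}
    (ht : t ∉ Set.Icc (-2) s) : expMulExt F t = 0 := by
  rw [Set.mem_Icc, not_and_or, not_le, not_le] at ht
  rcases ht with ht | ht
  · rw [expMulExt, Real.smoothTransition.zero_of_nonpos (by linarith), zero_mul]
  · rw [expMulExt, hF.eq_zero t ht, mul_zero, mul_zero]

/-- `Φ_F` has compact support. [folklore] -/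
theorem hasCompactSupport_expMulExt {F : ℝ → ℝ} {s : ℝ} (hF : IsSieveCutoff F s) :
    HasCompactSupport (expMulExt F) :=
  HasCompactSupport.intro isCompact_Icc fun _ ht => expMulExt_eq_zero hF ht

/-- The complexification `t ↦ (Φ_F(t) : ℂ)` is smooth. [folklore] -/
theorem contDiff_ofReal_expMulExt {F : ℝ → ℝ} (hF : ContDiff ℝ ∞ F) :
    ContDiff ℝ ∞ (fun t => (expMulExt F t : ℂ)) :=
  Complex.ofRealCLM.contDiff.comp (contDiff_expMulExt hF)

/-- The complexification of `Φ_F` has compact support. [folklore] -/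
theorem hasCompactSupport_ofReal_expMulExt {F : ℝ → ℝ} {s : ℝ} (hF : IsSieveCutoff F s) :
    HasCompactSupport (fun t => (expMulExt F t : ℂ)) :=
  (hasCompactSupport_expMulExt hF).comp_left Complex.ofReal_zero

/-- `Φ_F` as a Schwartz function `ℝ → ℂ`. [cite: Polymath8b2014, Lemma 4.1 (proof)] -/
def IsSieveCutoff.schwartzExt {F : ℝ → ℝ} {s : ℝ} (hF : IsSieveCutoff F s) : 𝓢(ℝ, ℂ) :=
  (hasCompactSupport_ofReal_expMulExt hF).toSchwartzMap (contDiff_ofReal_expMulExt hF.contDiff)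

/-- Values of the Schwartz extension. [folklore] -/
@[simp]
theorem IsSieveCutoff.schwartzExt_apply {F : ℝ → ℝ} {s : ℝ} (hF : IsSieveCutoff F s) (t : ℝ) :
    hF.schwartzExt t = (expMulExt F t : ℂ) := rfl

/-- The Fourier transform `f` of `Φ_F` ("for some fixed functions `f_j, g_j : ℝ → ℂ` that are smooth
and rapidly decreasing", Polymath 8b p. 12), a Schwartz function; normalisation of Mathlib:
`f(ξ) = ∫ Φ_F(t) e^{-2πi tξ} dt`. [cite: Polymath8b2014, Lemma 4.1 (proof), (etf)] -/
def IsSieveCutoff.fourierWeight {F : ℝ → ℝ} {s : ℝ} (hF : IsSieveCutoff F s) : 𝓢(ℝ, ℂ) :=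
  𝓕 hF.schwartzExt

/-- Rapid decay of `f`: `(1 + |ξ|)^n |f(ξ)| ≤ C_n` ("`f_j(ξ) = O((1+|ξ|)^{-A})` for any fixed `A > 0`").
[cite: Polymath8b2014, Lemma 4.1 (proof)] -/
theorem IsSieveCutoff.fourierWeight_decay {F : ℝ → ℝ} {s : ℝ} (hF : IsSieveCutoff F s) (n : ℕ) :
    ∃ C : ℝ, 0 ≤ C ∧ ∀ ξ : ℝ, (1 + |ξ|) ^ n * ‖hF.fourierWeight ξ‖ ≤ C := by
  refine ⟨2 ^ n * (Finset.Iic (n, 0)).sup (fun m => SchwartzMap.seminorm ℂ m.1 m.2) hF.fourierWeight,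
    by positivity, fun ξ => ?_⟩
  have h := SchwartzMap.one_add_le_sup_seminorm_apply (𝕜 := ℂ) (m := (n, 0)) (k := n) (n := 0)
    le_rfl le_rfl hF.fourierWeight ξ
  rwa [norm_iteratedFDeriv_zero, Real.norm_eq_abs] at h

/-- `f` is continuous. [folklore] -/
theorem IsSieveCutoff.continuous_fourierWeight {F : ℝ → ℝ} {s : ℝ} (hF : IsSieveCutoff F s) :
    Continuous hF.fourierWeight :=
  hF.fourierWeight.continuous

/-- `f` is integrable. [folklore] -/
theorem IsSieveCutoff.integrable_fourierWeight {F : ℝ → ℝ} {s : ℝ} (hF : IsSieveCutoff F s) :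
    Integrable hF.fourierWeight :=
  hF.fourierWeight.integrable

/-- `(1 + |ξ|) |f(ξ)|` is integrable. [folklore] -/
theorem IsSieveCutoff.integrable_one_add_abs_mul_fourierWeight {F : ℝ → ℝ} {s : ℝ}
    (hF : IsSieveCutoff F s) :
    Integrable fun ξ : ℝ => (1 + |ξ|) * ‖hF.fourierWeight ξ‖ := by
  have h0 := hF.fourierWeight.integrable_pow_mul volume 0
  have h1 := hF.fourierWeight.integrable_pow_mul volume 1
  simp only [pow_zero, one_mul, pow_one, Real.norm_eq_abs] at h0 h1
  exact (h0.add h1).congr (Eventually.of_forall fun ξ => by simp only [Pi.add_apply]; ring)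

/-- Fourier inversion for `Φ_F`: `Φ_F(t) = ∫ f(ξ) e^{2πi tξ} dξ`. [cite: Polymath8b2014, Lemma 4.1 (proof), (etf)] -/
theorem IsSieveCutoff.expMulExt_eq_integral {F : ℝ → ℝ} {s : ℝ} (hF : IsSieveCutoff F s) (t : ℝ) :
    (expMulExt F t : ℂ) = ∫ ξ : ℝ, Complex.exp (2 * π * Complex.I * ξ * t) * hF.fourierWeight ξ := by
  have hinv := hF.schwartzExt.continuous.fourierInv_fourier_eq hF.schwartzExt.integrable
    (𝓕 hF.schwartzExt).integrable
  have h := congr_fun hinv t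
  rw [Real.fourierInv_eq'] at h
  rw [← hF.schwartzExt_apply, ← h]
  refine integral_congr_ae (Eventually.of_forall fun ξ => ?_)
  simp only [smul_eq_mul, RCLike.inner_apply, conj_trivial]
  congr 1
  push_cast
  ring

/-- The exponential factor `e^{-t(1 - 2πiξ)}` of the Fourier expansion (etf) divided by `e^t`
(Mathlib's normalisation of the Fourier transform puts `-2πiξ` where the paper has `iξ`).
[cite: Polymath8b2014, Lemma 4.1 (proof)] -/
def lcmFourierKernel (t ξ : ℝ) : ℂ := Complex.exp (-(t : ℂ) * (1 - 2 * π * Complex.I * ξ))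

/-- `|e^{-t(1-2πiξ)}| = e^{-t}`. [folklore] -/
theorem norm_lcmFourierKernel (t ξ : ℝ) : ‖lcmFourierKernel t ξ‖ = Real.exp (-t) := by
  rw [lcmFourierKernel, Complex.norm_exp]
  congr 1
  simp [Complex.mul_re]

/-- `F(t) = ∫ f(ξ) e^{-t(1-2πiξ)} dξ` for `t ≥ -1` (in particular for all `t ≥ 0`): (etf) divided by
`e^t`, "`F_j(log_x d_j) = ∫ f_j(ξ_j) d_j^{-(1+iξ_j)/log x} dξ_j`". [cite: Polymath8b2014, Lemma 4.1 (proof), (etf)] -/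
theorem IsSieveCutoff.eq_integral_fourierWeight {F : ℝ → ℝ} {s : ℝ} (hF : IsSieveCutoff F s)
    {t : ℝ} (ht : -1 ≤ t) :
    (F t : ℂ) = ∫ ξ : ℝ, hF.fourierWeight ξ * lcmFourierKernel t ξ := by
  have h := hF.expMulExt_eq_integral t
  rw [expMulExt_eq ht] at h
  have hexp : (Real.exp t : ℂ) ≠ 0 := by exact_mod_cast (Real.exp_pos t).ne'
  have h2 : (F t : ℂ) = (Real.exp t : ℂ)⁻¹ *
      ∫ ξ : ℝ, Complex.exp (2 * π * Complex.I * ξ * t) * hF.fourierWeight ξ := by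
    rw [← h]; push_cast; field_simp
  rw [h2, ← integral_const_mul]
  refine integral_congr_ae (Eventually.of_forall fun ξ => ?_)
  beta_reduce
  rw [Complex.ofReal_exp, ← Complex.exp_neg, ← mul_assoc, ← Complex.exp_add, mul_comm,
    lcmFourierKernel]
  congr 2
  ring

/-- The derivative of `Φ_F` at `t > -1` is `e^t (F(t) + F'(t))`. [folklore] -/
theorem IsSieveCutoff.hasDerivAt_schwartzExt {F : ℝ → ℝ} {s : ℝ} (hF : IsSieveCutoff F s)
    {t : ℝ} (ht : -1 < t) :
    HasDerivAt (hF.schwartzExt : ℝ → ℂ)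
      ((Real.exp t * F t + Real.exp t * deriv F t : ℝ) : ℂ) t := by
  have hdF : HasDerivAt F (deriv F t) t :=
    ((hF.contDiff.differentiable (by simp)) t).hasDerivAt
  have h1 : HasDerivAt (fun u => Real.exp u * F u) (Real.exp t * F t + Real.exp t * deriv F t) t :=
    (Real.hasDerivAt_exp t).mul hdF
  have h2 : HasDerivAt (expMulExt F) (Real.exp t * F t + Real.exp t * deriv F t) t := by
    refine h1.congr_of_eventuallyEq ?_
    filter_upwards [eventually_gt_nhds ht] with u hu
    exact expMulExt_eq hu.le
  exact h2.ofReal_comp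

/-- `F'(t) = -∫ (1 - 2πiξ) f(ξ) e^{-t(1-2πiξ)} dξ` for `t > -1` ("dividing (etf) by `e^t` and
differentiating under the integral sign, `F_j'(t) = -∫ (1+iξ) e^{-t(1+iξ)} f_j(ξ) dξ`", p. 13; here
obtained from Fourier inversion applied to `Φ_F'`). [cite: Polymath8b2014, Lemma 4.1 (proof, p. 13)] -/
theorem IsSieveCutoff.deriv_eq_integral_fourierWeight {F : ℝ → ℝ} {s : ℝ} (hF : IsSieveCutoff F s)
    {t : ℝ} (ht : -1 < t) :
    ((deriv F t : ℝ) : ℂ) =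
      ∫ ξ : ℝ, -(1 - 2 * π * Complex.I * ξ) * hF.fourierWeight ξ * lcmFourierKernel t ξ := by
  set Φ : ℝ → ℂ := (hF.schwartzExt : ℝ → ℂ) with hΦdef
  have hΦsmooth : ContDiff ℝ ∞ Φ := hF.schwartzExt.smooth ⊤
  have hΦdiff : Differentiable ℝ Φ := hΦsmooth.differentiable (by simp)
  have hΦint : Integrable Φ := hF.schwartzExt.integrable
  have hΦsupp : HasCompactSupport Φ := hasCompactSupport_ofReal_expMulExt hF
  have hΦ'cont : Continuous (deriv Φ) := hΦsmooth.continuous_deriv (by exact_mod_cast le_top)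
  have hΦ'int : Integrable (deriv Φ) := hΦ'cont.integrable_of_hasCompactSupport hΦsupp.deriv
  -- Fourier transform of the derivative
  have hFd : 𝓕 (deriv Φ) = fun ξ : ℝ => (2 * π * Complex.I * ξ) • 𝓕 Φ ξ :=
    Real.fourier_deriv hΦint hΦdiff hΦ'int
  have hFΦ : 𝓕 Φ = (hF.fourierWeight : ℝ → ℂ) := rfl
  have hFd_int : Integrable (𝓕 (deriv Φ)) := by
    rw [hFd, hFΦ]
    have hi := (hF.integrable_one_add_abs_mul_fourierWeight).const_mul (2 * π)
    refine hi.mono' ?_ (Eventually.of_forall fun ξ => ?_)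
    · exact ((by fun_prop : Continuous fun ξ : ℝ => (2 * π * Complex.I * ξ)).smul
        hF.continuous_fourierWeight).aestronglyMeasurable
    · rw [norm_smul]
      have hn : ‖(2 * π * Complex.I * ξ : ℂ)‖ = 2 * π * |ξ| := by
        simp [Complex.norm_real, abs_of_pos Real.pi_pos]
      rw [hn]
      have h0 : 0 ≤ ‖hF.fourierWeight ξ‖ := norm_nonneg _
      nlinarith [abs_nonneg ξ, Real.pi_pos]
  -- Fourier inversion for the derivative
  have hinv := hΦ'cont.fourierInv_fourier_eq hΦ'int hFd_int
  have hderiv : deriv Φ t = ((Real.exp t * F t + Real.exp t * deriv F t : ℝ) : ℂ) :=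
    (hF.hasDerivAt_schwartzExt ht).deriv
  have key : ((Real.exp t * F t + Real.exp t * deriv F t : ℝ) : ℂ) =
      ∫ ξ : ℝ, Complex.exp (2 * π * Complex.I * ξ * t) *
        ((2 * π * Complex.I * ξ) * hF.fourierWeight ξ) := by
    rw [← hderiv, ← congr_fun hinv t, Real.fourierInv_eq', hFd, hFΦ]
    refine integral_congr_ae (Eventually.of_forall fun ξ => ?_)
    simp only [smul_eq_mul, RCLike.inner_apply, conj_trivial]
    congr 1
    push_cast
    ring
  -- the representation of `e^t F(t)`
  have hrep := hF.expMulExt_eq_integral t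
  rw [expMulExt_eq ht.le] at hrep
  -- subtract
  have hint1 : Integrable fun ξ : ℝ => Complex.exp (2 * π * Complex.I * ξ * t) *
      ((2 * π * Complex.I * ξ) * hF.fourierWeight ξ) := by
    have hi := (hF.integrable_one_add_abs_mul_fourierWeight).const_mul (2 * π)
    refine hi.mono' ?_ (Eventually.of_forall fun ξ => ?_)
    · exact (((by fun_prop : Continuous fun ξ : ℝ => Complex.exp (2 * π * Complex.I * ξ * t))).mul
        (((by fun_prop : Continuous fun ξ : ℝ => (2 * π * Complex.I * ξ : ℂ))).mul
          hF.continuous_fourierWeight)).aestronglyMeasurable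
    · rw [norm_mul, norm_mul, Complex.norm_exp]
      have hre : (2 * π * Complex.I * ξ * t : ℂ).re = 0 := by simp [Complex.mul_re]
      rw [hre, Real.exp_zero, one_mul]
      have hn : ‖(2 * π * Complex.I * ξ : ℂ)‖ = 2 * π * |ξ| := by
        simp [Complex.norm_real, abs_of_pos Real.pi_pos]
      rw [hn]
      have h0 : 0 ≤ ‖hF.fourierWeight ξ‖ := norm_nonneg _
      nlinarith [abs_nonneg ξ, Real.pi_pos]
  have hint2 : Integrable fun ξ : ℝ => Complex.exp (2 * π * Complex.I * ξ * t) *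
      hF.fourierWeight ξ := by
    refine hF.integrable_fourierWeight.norm.mono' ?_ (Eventually.of_forall fun ξ => ?_)
    · exact (((by fun_prop : Continuous fun ξ : ℝ => Complex.exp (2 * π * Complex.I * ξ * t))).mul
        hF.continuous_fourierWeight).aestronglyMeasurable
    · rw [norm_mul, Complex.norm_exp]
      have hre : (2 * π * Complex.I * ξ * t : ℂ).re = 0 := by simp [Complex.mul_re]
      rw [hre, Real.exp_zero, one_mul]
  have hsub : ((Real.exp t * deriv F t : ℝ) : ℂ) =
      ∫ ξ : ℝ, Complex.exp (2 * π * Complex.I * ξ * t) *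
        ((2 * π * Complex.I * ξ - 1) * hF.fourierWeight ξ) := by
    have e1 : ((Real.exp t * deriv F t : ℝ) : ℂ) =
        ((Real.exp t * F t + Real.exp t * deriv F t : ℝ) : ℂ) - ((Real.exp t * F t : ℝ) : ℂ) := by
      push_cast; ring
    rw [e1, key, hrep, ← integral_sub hint1 hint2]
    refine integral_congr_ae (Eventually.of_forall fun ξ => ?_)
    ring
  have hexp : (Real.exp t : ℂ) ≠ 0 := by exact_mod_cast (Real.exp_pos t).ne'
  have h2 : ((deriv F t : ℝ) : ℂ) = (Real.exp t : ℂ)⁻¹ *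
      ∫ ξ : ℝ, Complex.exp (2 * π * Complex.I * ξ * t) *
        ((2 * π * Complex.I * ξ - 1) * hF.fourierWeight ξ) := by
    rw [← hsub]; push_cast; field_simp
  rw [h2, ← integral_const_mul]
  refine integral_congr_ae (Eventually.of_forall fun ξ => ?_)
  beta_reduce
  rw [Complex.ofReal_exp, ← Complex.exp_neg, ← mul_assoc, ← Complex.exp_add, lcmFourierKernel]
  have e3 : -(t : ℂ) + 2 * π * Complex.I * ξ * t = -(t : ℂ) * (1 - 2 * π * Complex.I * ξ) := by ring
  rw [e3]
  ring

/-! ### The identity `∫∫ (1+iξ)(1+iξ')/(2+iξ+iξ') f(ξ) g(ξ') dξ dξ' = ∫_0^∞ F'(t) G'(t) dt` -/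

/-- The kernel `(1 - 2πiξ)(1 - 2πiξ')/(2 - 2πi(ξ + ξ'))` (the paper's `(1+iξ)(1+iξ')/(2+iξ+iξ')` in
Mathlib's normalisation of the Fourier transform). [cite: Polymath8b2014, Lemma 4.1 (proof, p. 13)] -/
def lcmPairKernel (p : ℝ × ℝ) : ℂ :=
  (1 - 2 * π * Complex.I * p.1) * (1 - 2 * π * Complex.I * p.2) /
    (2 - 2 * π * Complex.I * (p.1 + p.2))

/-- The denominator `2 - 2πi(ξ + ξ')` has real part `2`, so it does not vanish. [folklore] -/
theorem two_sub_twoPiI_ne_zero (ξ ξ' : ℝ) : (2 - 2 * π * Complex.I * (ξ + ξ') : ℂ) ≠ 0 := by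
  intro h
  have := congr_arg Complex.re h
  simp [Complex.mul_re] at this

/-- `|1 - 2πiξ| ≤ 1 + 2π|ξ|`. [folklore] -/
theorem norm_one_sub_twoPiI_le (ξ : ℝ) : ‖(1 - 2 * π * Complex.I * ξ : ℂ)‖ ≤ 1 + 2 * π * |ξ| := by
  refine (norm_sub_le _ _).trans ?_
  simp [Complex.norm_real, abs_of_pos Real.pi_pos]

/-- `|lcmPairKernel(ξ, ξ')| ≤ (1 + 2π|ξ|)(1 + 2π|ξ'|)/2`. [folklore] -/
theorem norm_lcmPairKernel_le (p : ℝ × ℝ) :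
    ‖lcmPairKernel p‖ ≤ (1 + 2 * π * |p.1|) * (1 + 2 * π * |p.2|) / 2 := by
  rw [lcmPairKernel, norm_div, norm_mul]
  have h2 : (2 : ℝ) ≤ ‖(2 - 2 * π * Complex.I * (p.1 + p.2) : ℂ)‖ := by
    have := Complex.abs_re_le_norm (2 - 2 * π * Complex.I * (p.1 + p.2) : ℂ)
    simp [Complex.mul_re] at this
    simpa using this
  have hpos : (0 : ℝ) < ‖(2 - 2 * π * Complex.I * (p.1 + p.2) : ℂ)‖ := by linarith
  rw [div_le_div_iff₀ hpos (by norm_num : (0:ℝ) < 2)]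
  have ha := norm_one_sub_twoPiI_le p.1
  have hb := norm_one_sub_twoPiI_le p.2
  have h0 : 0 ≤ ‖(1 - 2 * π * Complex.I * p.1 : ℂ)‖ := norm_nonneg _
  have h0' : 0 ≤ ‖(1 - 2 * π * Complex.I * p.2 : ℂ)‖ := norm_nonneg _
  have hprod : ‖(1 - 2 * π * Complex.I * p.1 : ℂ)‖ * ‖(1 - 2 * π * Complex.I * p.2 : ℂ)‖ ≤
      (1 + 2 * π * |p.1|) * (1 + 2 * π * |p.2|) := mul_le_mul ha hb h0' (by positivity)
  have hP : 0 ≤ (1 + 2 * π * |p.1|) * (1 + 2 * π * |p.2|) := by positivity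
  calc _ ≤ (1 + 2 * π * |p.1|) * (1 + 2 * π * |p.2|) * 2 := by nlinarith
    _ ≤ _ := by gcongr

/-- `lcmPairKernel` is continuous. [folklore] -/
theorem continuous_lcmPairKernel : Continuous lcmPairKernel := by
  unfold lcmPairKernel
  refine Continuous.div (by fun_prop) (by fun_prop) fun p => two_sub_twoPiI_ne_zero p.1 p.2

/-- `e^{-t(1-2πiξ)} e^{-t(1-2πiξ')} = e^{-(2 - 2πi(ξ+ξ'))t}`. [folklore] -/
theorem lcmFourierKernel_mul (t ξ ξ' : ℝ) :
    lcmFourierKernel t ξ * lcmFourierKernel t ξ' =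
      Complex.exp (-(2 - 2 * π * Complex.I * (ξ + ξ')) * (t : ℂ)) := by
  rw [lcmFourierKernel, lcmFourierKernel, ← Complex.exp_add]
  congr 1
  ring

/-- `∫_0^∞ e^{-t(1-2πiξ)} e^{-t(1-2πiξ')} dt = 1/(2 - 2πi(ξ + ξ'))`. [folklore] -/
theorem integral_Ioi_lcmFourierKernel_mul (ξ ξ' : ℝ) :
    ∫ t in Set.Ioi (0 : ℝ), lcmFourierKernel t ξ * lcmFourierKernel t ξ' =
      1 / (2 - 2 * π * Complex.I * (ξ + ξ')) := by
  simp_rw [lcmFourierKernel_mul]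
  have ha : (-(2 - 2 * π * Complex.I * (ξ + ξ')) : ℂ).re < 0 := by
    simp [Complex.mul_re]
  rw [integral_exp_mul_complex_Ioi ha 0]
  simp only [Complex.ofReal_zero, mul_zero, Complex.exp_zero]
  have hne := two_sub_twoPiI_ne_zero ξ ξ'
  field_simp

/-- Continuity of the Fourier kernel in both variables. [folklore] -/
theorem continuous_lcmFourierKernel : Continuous fun q : ℝ × ℝ => lcmFourierKernel q.1 q.2 := by
  unfold lcmFourierKernel; fun_prop

/-- **The Fourier-side evaluation of `∫_0^∞ F' G'`** (Polymath 8b, end of the proof of Lemma 4.1,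
p. 13): "it suffices to show that `∫∫ (1+iξ)(1+iξ')/(2+iξ+iξ') f_j(ξ) g_j(ξ') dξ dξ' = ∫_0^∞ F_j'(t) G_j'(t) dt`
… But from dividing (etf) by `e^t` and differentiating under the integral sign, we have
`F_j'(t) = -∫ (1+iξ) e^{-t(1+iξ)} f_j(ξ) dξ`, and the claim then follows from Fubini's theorem."
(Here with Mathlib's `-2πiξ` for the paper's `iξ`.) [cite: Polymath8b2014, Lemma 4.1 (proof, p. 13)] -/
theorem integral_Ioi_deriv_mul_deriv_eq {F G : ℝ → ℝ} {s s' : ℝ} (hF : IsSieveCutoff F s)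
    (hG : IsSieveCutoff G s') :
    ((∫ t in Set.Ioi (0 : ℝ), deriv F t * deriv G t : ℝ) : ℂ) =
      ∫ p : ℝ × ℝ, lcmPairKernel p * (hF.fourierWeight p.1 * hG.fourierWeight p.2) := by
  -- the weights `u = -(1-2πiξ) f(ξ)`, `v = -(1-2πiξ') g(ξ')`
  set u : ℝ → ℂ := fun ξ => -(1 - 2 * π * Complex.I * ξ) * hF.fourierWeight ξ with hudef
  set v : ℝ → ℂ := fun ξ => -(1 - 2 * π * Complex.I * ξ) * hG.fourierWeight ξ with hvdef
  have hucont : Continuous u := by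
    simp only [hudef]; exact (by fun_prop : Continuous fun ξ : ℝ => -(1 - 2 * π * Complex.I * ξ : ℂ)).mul
      hF.continuous_fourierWeight
  have hvcont : Continuous v := by
    simp only [hvdef]; exact (by fun_prop : Continuous fun ξ : ℝ => -(1 - 2 * π * Complex.I * ξ : ℂ)).mul
      hG.continuous_fourierWeight
  have hbound : ∀ (w : ℝ → ℂ) (ξ : ℝ), ‖-(1 - 2 * π * Complex.I * ξ) * w ξ‖ ≤
      (2 * π) * ((1 + |ξ|) * ‖w ξ‖) := by
    intro w ξ
    rw [norm_mul, norm_neg]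
    have h1 := norm_one_sub_twoPiI_le ξ
    have h2 : 1 + 2 * π * |ξ| ≤ 2 * π * (1 + |ξ|) := by
      have := Real.pi_gt_three; nlinarith [abs_nonneg ξ]
    calc _ ≤ (2 * π * (1 + |ξ|)) * ‖w ξ‖ :=
          mul_le_mul_of_nonneg_right (h1.trans h2) (norm_nonneg _)
      _ = _ := by ring
  have huint : Integrable u :=
    (hF.integrable_one_add_abs_mul_fourierWeight.const_mul (2 * π)).mono'
      hucont.aestronglyMeasurable (Eventually.of_forall fun ξ => hbound _ ξ)
  have hvint : Integrable v :=
    (hG.integrable_one_add_abs_mul_fourierWeight.const_mul (2 * π)).mono'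
      hvcont.aestronglyMeasurable (Eventually.of_forall fun ξ => hbound _ ξ)
  -- Step 1: the real integral as a complex one, and the derivatives as Fourier integrals
  have hderF : ∀ t ∈ Set.Ioi (0 : ℝ), ((deriv F t : ℝ) : ℂ) = ∫ ξ, u ξ * lcmFourierKernel t ξ :=
    fun t ht => hF.deriv_eq_integral_fourierWeight (by linarith [Set.mem_Ioi.1 ht])
  have hderG : ∀ t ∈ Set.Ioi (0 : ℝ), ((deriv G t : ℝ) : ℂ) = ∫ ξ, v ξ * lcmFourierKernel t ξ :=
    fun t ht => hG.deriv_eq_integral_fourierWeight (by linarith [Set.mem_Ioi.1 ht])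
  -- the integrand on `(0,∞) × ℝ²`
  set Hf : ℝ → ℝ × ℝ → ℂ := fun t p =>
    (u p.1 * lcmFourierKernel t p.1) * (v p.2 * lcmFourierKernel t p.2) with hHdef
  have hstep1 : ((∫ t in Set.Ioi (0 : ℝ), deriv F t * deriv G t : ℝ) : ℂ) =
      ∫ t in Set.Ioi (0 : ℝ), ∫ p : ℝ × ℝ, Hf t p := by
    rw [← integral_complex_ofReal]
    refine setIntegral_congr_fun measurableSet_Ioi fun t ht => ?_
    simp only [hHdef]
    rw [Complex.ofReal_mul, hderF t ht, hderG t ht, ← integral_prod_mul]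
    rfl
  -- integrability on the product
  have hHint : Integrable (Function.uncurry Hf) ((volume.restrict (Set.Ioi (0 : ℝ))).prod volume) := by
    have hdom : Integrable (fun z : ℝ × (ℝ × ℝ) => Real.exp (-2 * z.1) * (‖u z.2.1‖ * ‖v z.2.2‖))
        ((volume.restrict (Set.Ioi (0 : ℝ))).prod volume) := by
      refine Integrable.mul_prod (f := fun t : ℝ => Real.exp (-2 * t)) ?_ (huint.norm.mul_prod hvint.norm)
      exact exp_neg_integrableOn_Ioi 0 (by norm_num)
    refine hdom.mono' ?_ (Eventually.of_forall fun z => ?_)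
    · have hc : Continuous (Function.uncurry Hf) := by
        simp only [hHdef, Function.uncurry_def]
        have hk1 : Continuous fun z : ℝ × (ℝ × ℝ) => lcmFourierKernel z.1 z.2.1 :=
          continuous_lcmFourierKernel.comp (continuous_fst.prodMk (continuous_fst.comp continuous_snd))
        have hk2 : Continuous fun z : ℝ × (ℝ × ℝ) => lcmFourierKernel z.1 z.2.2 :=
          continuous_lcmFourierKernel.comp (continuous_fst.prodMk (continuous_snd.comp continuous_snd))
        exact ((hucont.comp (continuous_fst.comp continuous_snd)).mul hk1).mul
          ((hvcont.comp (continuous_snd.comp continuous_snd)).mul hk2)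
      exact hc.aestronglyMeasurable
    · rcases z with ⟨t, ξ, ξ'⟩
      simp only [hHdef, hudef, hvdef, Function.uncurry_apply_pair, norm_mul, norm_neg,
        norm_lcmFourierKernel]
      have e2 : Real.exp (-2 * t) = Real.exp (-t) * Real.exp (-t) := by
        rw [← Real.exp_add]; ring_nf
      rw [e2]
      exact le_of_eq (by ring)
  -- Step 2: Fubini
  have hstep2 : ∫ t in Set.Ioi (0 : ℝ), ∫ p : ℝ × ℝ, Hf t p =
      ∫ p : ℝ × ℝ, ∫ t in Set.Ioi (0 : ℝ), Hf t p :=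
    integral_integral_swap hHint
  -- Step 3: the inner `t`-integral
  have hstep3 : ∀ p : ℝ × ℝ, ∫ t in Set.Ioi (0 : ℝ), Hf t p =
      lcmPairKernel p * (hF.fourierWeight p.1 * hG.fourierWeight p.2) := by
    intro p
    have e1 : (fun t => Hf t p) = fun t => (u p.1 * v p.2) * (lcmFourierKernel t p.1 * lcmFourierKernel t p.2) := by
      ext t; simp only [hHdef]; ring
    rw [e1, integral_const_mul, integral_Ioi_lcmFourierKernel_mul]
    simp only [hudef, hvdef, lcmPairKernel]
    have hne := two_sub_twoPiI_ne_zero p.1 p.2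
    field_simp
    try ring
  rw [hstep1, hstep2]
  exact integral_congr_ae (Eventually.of_forall hstep3)

/-! ### Tails of the rapidly decreasing weights -/

/-- `(1 + |ξ|)^{-2}` is integrable on `ℝ`. [folklore] -/
theorem integrable_one_add_abs_pow_neg_two :
    Integrable fun ξ : ℝ => ((1 + |ξ|) ^ 2)⁻¹ := by
  have h := integrable_one_add_norm (E := ℝ) (μ := volume) (r := 2)
    (by rw [Module.finrank_self]; norm_num)
  refine h.congr (Eventually.of_forall fun ξ => ?_)
  simp only [Real.norm_eq_abs]
  rw [Real.rpow_neg (by positivity), Real.rpow_two]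

/-- `(1 + |ξ|)^m |f(ξ)|` is integrable for every `m` (rapid decay). [folklore] -/
theorem IsSieveCutoff.integrable_pow_mul_norm_fourierWeight {F : ℝ → ℝ} {s : ℝ}
    (hF : IsSieveCutoff F s) (m : ℕ) :
    Integrable fun ξ : ℝ => (1 + |ξ|) ^ m * ‖hF.fourierWeight ξ‖ := by
  obtain ⟨C, hC0, hC⟩ := hF.fourierWeight_decay (m + 2)
  refine (integrable_one_add_abs_pow_neg_two.const_mul C).mono' ?_
    (Eventually.of_forall fun ξ => ?_)
  · exact ((by fun_prop : Continuous fun ξ : ℝ => (1 + |ξ|) ^ m).mul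
      hF.continuous_fourierWeight.norm).aestronglyMeasurable
  · have hpos : 0 < (1 + |ξ|) ^ 2 := by positivity
    rw [Real.norm_of_nonneg (by positivity), ← div_eq_mul_inv, le_div_iff₀ hpos]
    calc (1 + |ξ|) ^ m * ‖hF.fourierWeight ξ‖ * (1 + |ξ|) ^ 2
        = (1 + |ξ|) ^ (m + 2) * ‖hF.fourierWeight ξ‖ := by ring
      _ ≤ C := hC ξ

/-- Tail bound: `∫_{|ξ| > R} (1 + |ξ|)^m |f(ξ)| dξ ≤ C_{m,n} (1 + R)^{-n}` for all `R ≥ 0` ("the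
contribution … outside of the cube `{max(|ξ_j|, |ξ'_j|) ≤ √log x}` is negligible", thanks to the
rapid decrease of `f_j, g_j`). [cite: Polymath8b2014, Lemma 4.1 (proof, p. 12)] -/
theorem IsSieveCutoff.setIntegral_tail_fourierWeight_le {F : ℝ → ℝ} {s : ℝ}
    (hF : IsSieveCutoff F s) (m n : ℕ) :
    ∃ C : ℝ, 0 ≤ C ∧ ∀ R : ℝ, 0 ≤ R →
      ∫ ξ in {ξ : ℝ | R < |ξ|}, (1 + |ξ|) ^ m * ‖hF.fourierWeight ξ‖ ≤ C / (1 + R) ^ n := by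
  obtain ⟨C, hC0, hC⟩ := hF.fourierWeight_decay (m + n + 2)
  set I₂ : ℝ := ∫ ξ : ℝ, ((1 + |ξ|) ^ 2)⁻¹ with hI₂
  have hI₂0 : 0 ≤ I₂ := integral_nonneg fun ξ => by positivity
  refine ⟨C * I₂, by positivity, fun R hR => ?_⟩
  have hmeas : MeasurableSet {ξ : ℝ | R < |ξ|} :=
    measurableSet_lt measurable_const (measurable_id.abs)
  have hRn : 0 < (1 + R) ^ n := by positivity
  -- pointwise bound on the tail set
  have hpt : ∀ ξ ∈ {ξ : ℝ | R < |ξ|}, (1 + |ξ|) ^ m * ‖hF.fourierWeight ξ‖ ≤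
      C / (1 + R) ^ n * ((1 + |ξ|) ^ 2)⁻¹ := by
    intro ξ hξ
    have hξ' : R < |ξ| := hξ
    have h1 : (1 + R) ^ n ≤ (1 + |ξ|) ^ n := pow_le_pow_left₀ (by positivity) (by linarith) n
    have hpos2 : 0 < (1 + |ξ|) ^ 2 := by positivity
    have hposn : 0 < (1 + |ξ|) ^ n := by positivity
    rw [← div_eq_mul_inv, div_div, le_div_iff₀ (by positivity)]
    calc (1 + |ξ|) ^ m * ‖hF.fourierWeight ξ‖ * ((1 + R) ^ n * (1 + |ξ|) ^ 2)
        ≤ (1 + |ξ|) ^ m * ‖hF.fourierWeight ξ‖ * ((1 + |ξ|) ^ n * (1 + |ξ|) ^ 2) := by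
          gcongr
      _ = (1 + |ξ|) ^ (m + n + 2) * ‖hF.fourierWeight ξ‖ := by ring
      _ ≤ C := hC ξ
  calc ∫ ξ in {ξ : ℝ | R < |ξ|}, (1 + |ξ|) ^ m * ‖hF.fourierWeight ξ‖
      ≤ ∫ ξ in {ξ : ℝ | R < |ξ|}, C / (1 + R) ^ n * ((1 + |ξ|) ^ 2)⁻¹ :=
        setIntegral_mono_on (hF.integrable_pow_mul_norm_fourierWeight m).integrableOn
          ((integrable_one_add_abs_pow_neg_two.const_mul _).integrableOn) hmeas hpt
    _ ≤ ∫ ξ : ℝ, C / (1 + R) ^ n * ((1 + |ξ|) ^ 2)⁻¹ :=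
        setIntegral_le_integral (integrable_one_add_abs_pow_neg_two.const_mul _)
          (Eventually.of_forall fun ξ => by positivity)
    _ = C * I₂ / (1 + R) ^ n := by
        rw [integral_const_mul, hI₂]; ring

end Literature.NumberTheory.Sieve
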